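import Summits.ResolutionOfSingularities.ResolutionOfSingularities.Theorems.PurelyInseparableDim4Rules
import Summits.ResolutionOfSingularities.ResolutionOfSingularities.Theorems.PurelyInseparableDim4StepKitState
import HarnessLib

/-!
# Trap certificates: a kernel-evaluable checker over the STEP KIT and its SOUNDNESS (cell `res-dim4-pi`, TY-10)

[OURS · counted 0 · instrument] Nothing here is a statement about resolution of singularities.

The trap census (eng-w5 `traps_literal.json`, W3-13) lists finite sets `T` of presented states of
`z^q + F(x₁..x₄)` closed under «every Hironaka-permissible coordinate centre `S` is answered by a chart
point leading back into `T`» — the kill-certificate shape `PIDim4.IsTrap` of the Rules add-on.  This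
module fixes the ROW GRAMMAR of a certificate over res-dim4-p-13's step kit (`StepKit.SData`, `stepD`,
`permB`, `equiB`, `equivB`) and proves the checker SOUND:

* `TrapCert.Move K` — a recorded move `(S, j, b, child)`; `TrapCert.Cert K` — a list of rows
  `(s : StepKit.SData 4 K, moves : List (Move K))`;
* `TrapCert.certB q T : Bool` — `T ≠ []`, every row has `q ≤ ord F` and, for EVERY coordinate centre `S`
  with `permB q S` (all 15 are tried), some recorded move with `m.S = S`, `m.j ∈ S`, `m.b (m.j) = 0` passes
  `equiB` (equimultiple point), has non-zero cleaned transform, and `stepD` of it IS (`SData.equivB`) the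
  row `T[m.child]`;
* **`TrapCert.isTrap_of_certB : certB q T = true → IsTrap q (states T)`** (with `states_nonempty`), hence
  `not_terminatesUnder_of_certB` / `not_terminatesSomeRule_of_certB`: a `decide`d certificate is a theorem
  `IsTrap q T` about the TREE's `CentreBlowup.step`, and a kill of `TerminatesSomeRule p q` over that field.

Batches (res-dim4-typ-3g7, W3-13: `def B : List (Cert (ZMod 2)) := […]`, `theorem hB : (B.all (certB 2)) =
true := by decide`, then `isTrap_of_all_certB hB`) import this file and stay data-only.
bears_on: LADDER-RESOLUTION:D157-DOOR2 (res-dim4-pi · TY-10 · W3-13). Supports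
stmt-ResolutionOfSingularities-16155 (helper).
-/

set_option linter.dupNamespace false -- mandated namespace of this single-conjunct summit

namespace Summit.ResolutionOfSingularities.ResolutionOfSingularities.Theorems.PIDim4

namespace TrapCert

open StepKit
open Literature.AlgebraicGeometry.Resolution

variable {K : Type} [Field K] [DecidableEq K]

/-- A recorded move of a trap certificate: centre `S`, chart `j`, translation `b`, and the index of the
child row. [folklore] -/
structure Move (K : Type) where
  /-- the coordinate centre `V(z, x_S)` -/
  S : Finset (Fin 4)
  /-- the chart `j ∈ S` -/
  j : Fin 4
  /-- the point of the exceptional hyperplane (`b j = 0`) -/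
  b : Fin 4 → K
  /-- index of the child state in the certificate -/
  child : ℕ

/-- A certificate row: a presented state with its recorded moves. [folklore] -/
abbrev Row (K : Type) : Type := StepKit.SData 4 K × List (Move K)

/-- A trap certificate: a list of rows. [folklore] -/
abbrev Cert (K : Type) : Type := List (Row K)

/-- The child check: row `c` exists and `stepD` of the move is (presents the same state as) its state.
[folklore] -/
def childOK (q : ℕ) (T : Cert K) (s : SData 4 K) (S : Finset (Fin 4)) (j : Fin 4) (b : Fin 4 → K)
    (c : ℕ) : Bool :=
  match T[c]? with
  | none => false
  | some row => (stepD q S j b s).equivB row.1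

/-- The move `m` answers the centre `S` at the state `s` inside `T`. [folklore] -/
def moveOK (q : ℕ) (T : Cert K) (s : SData 4 K) (S : Finset (Fin 4)) (m : Move K) : Bool :=
  decide (m.S = S) && decide (m.j ∈ S) && decide (m.b m.j = 0) && equiB q S m.j m.b s &&
    !(StepKit.equivB (stepD q S m.j m.b s).L []) && childOK q T s S m.j m.b m.child

/-- The row check: `q`-fold origin, and every permissible coordinate centre answered by a recorded move.
[folklore] -/
def rowOK (q : ℕ) (T : Cert K) (row : Row K) : Bool :=
  permB q Finset.univ row.1.L &&
    decide (∀ S : Finset (Fin 4), permB q S row.1.L = true → row.2.any (moveOK q T row.1 S) = true)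

/-- **The certificate checker.** [folklore] -/
def certB (q : ℕ) (T : Cert K) : Bool := !T.isEmpty && T.all (rowOK q T)

/-- The set of tree states presented by the certificate. [folklore] -/
def states (T : Cert K) : Set (State K) := {x | ∃ row ∈ T, row.1.toState = x}

omit [DecidableEq K] in
/-- A row's state is in `states T`. [folklore] -/
theorem mem_states {T : Cert K} {row : Row K} (h : row ∈ T) : row.1.toState ∈ states T := ⟨row, h, rfl⟩

/-- Soundness of the child check. [folklore] -/
theorem exists_of_childOK {q : ℕ} {T : Cert K} {s : SData 4 K} {S : Finset (Fin 4)} {j : Fin 4}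
    {b : Fin 4 → K} {c : ℕ} (h : childOK q T s S j b c = true) :
    ∃ row ∈ T, (stepD q S j b s).equivB row.1 = true := by
  unfold childOK at h
  cases hc : T[c]? with
  | none => rw [hc] at h; exact absurd h Bool.false_ne_true
  | some row => rw [hc] at h; exact ⟨row, List.mem_of_getElem? hc, h⟩

/-- Soundness of the move check: an `Edge` into `states T`. [folklore] -/
theorem exists_edge_of_moveOK {q : ℕ} {T : Cert K} {s : SData 4 K} {S : Finset (Fin 4)} {m : Move K}
    (h : moveOK q T s S m = true) : ∃ s' ∈ states T, Edge q S s.toState s' := by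
  simp only [moveOK, Bool.and_eq_true, decide_eq_true_eq, Bool.not_eq_true'] at h
  obtain ⟨⟨⟨⟨⟨-, hj⟩, hb⟩, h1⟩, h2⟩, h3⟩ := h
  obtain ⟨row, hrow, h3'⟩ := exists_of_childOK h3
  exact ⟨row.1.toState, mem_states hrow, edge_of m.j m.b hj hb h1 h2 h3'⟩

/-- **SOUNDNESS**: a checked certificate is a trap for the TREE's step (`PIDim4.IsTrap`). [folklore] -/
theorem isTrap_of_certB {q : ℕ} {T : Cert K} (hT : certB q T = true) : IsTrap q (states T) := by
  intro x hx
  obtain ⟨row, hrow, rfl⟩ := hx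
  have hrowOK : rowOK q T row = true := by
    simp only [certB, Bool.and_eq_true, List.all_eq_true] at hT
    exact hT.2 row hrow
  simp only [rowOK, Bool.and_eq_true, decide_eq_true_eq] at hrowOK
  obtain ⟨hperm, hall⟩ := hrowOK
  refine ⟨((isPermissibleCentre_iff q Finset.univ row.1.L).mpr hperm).2, fun S hS => ?_⟩
  have hSb : permB q S row.1.L = true := (isPermissibleCentre_iff q S row.1.L).mp hS
  obtain ⟨m, -, hm⟩ := List.any_eq_true.mp (hall S hSb)
  exact exists_edge_of_moveOK hm

omit [DecidableEq K] in
/-- A non-empty certificate presents a non-empty set of states. [folklore] -/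
theorem states_nonempty_of {T : Cert K} (hT : T ≠ []) : (states T).Nonempty := by
  obtain ⟨row, hrow⟩ := List.exists_mem_of_ne_nil T hT
  exact ⟨row.1.toState, mem_states hrow⟩

/-- A checked certificate is non-empty. [folklore] -/
theorem states_nonempty {q : ℕ} {T : Cert K} (hT : certB q T = true) : (states T).Nonempty := by
  apply states_nonempty_of
  simp only [certB, Bool.and_eq_true, Bool.not_eq_true', List.isEmpty_eq_false_iff] at hT
  exact hT.1

/-- **A checked certificate defeats every permissible coordinate-centre rule over `K`.** [folklore] -/
theorem not_terminatesUnder_of_certB {q : ℕ} {T : Cert K} (hT : certB q T = true) (R : CentreRule K)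
    (hR : IsPermissibleRule q R) : ¬ TerminatesUnder q R :=
  not_terminatesUnder_of_trap q (states T) (isTrap_of_certB hT) (states_nonempty hT) R hR

/-- **A checked certificate over a field of characteristic `p` refutes `TerminatesSomeRule p q`.**
[folklore] -/
theorem not_terminatesSomeRule_of_certB (p q : ℕ) [CharP K p] {T : Cert K} (hT : certB q T = true) :
    ¬ TerminatesSomeRule p q :=
  not_terminatesSomeRule_of_trap p q K (states T) (isTrap_of_certB hT) (states_nonempty hT)

/-! ## Batches (data-only batch files: `theorem … : (B.all (certB q)) = true := by decide`) -/

/-- **Batch form of soundness**: if every certificate of the list `B` checks, each presents a trap.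
[folklore] -/
theorem isTrap_of_all_certB {q : ℕ} {B : List (Cert K)} (hB : (B.all (certB q)) = true) :
    ∀ T ∈ B, IsTrap q (states T) := fun T hT =>
  isTrap_of_certB ((List.all_eq_true.mp hB) T hT)

/-- Batch form: every certificate of a checked batch has a non-empty state set. [folklore] -/
theorem states_nonempty_of_all_certB {q : ℕ} {B : List (Cert K)} (hB : (B.all (certB q)) = true) :
    ∀ T ∈ B, (states T).Nonempty := fun T hT =>
  states_nonempty ((List.all_eq_true.mp hB) T hT)

/-- Batch form of the kill: a non-empty checked batch over a field of characteristic `p` refutes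
`TerminatesSomeRule p q` (once; every member is a witness). [folklore] -/
theorem not_terminatesSomeRule_of_all_certB (p q : ℕ) [CharP K p] {B : List (Cert K)}
    (hB : (B.all (certB q)) = true) (hne : B ≠ []) : ¬ TerminatesSomeRule p q := by
  obtain ⟨T, hT⟩ := List.exists_mem_of_ne_nil B hne
  exact not_terminatesSomeRule_of_certB p q ((List.all_eq_true.mp hB) T hT)

/-! ## Worked example (row grammar): TRAP-1 as a one-row certificate over `𝔽₂` -/

/-- TRAP-1 (`Theorems/PurelyInseparableDim4CoordinateTrap`, res-dim4-idea-3) in the row grammar: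
the state `(x₃x₄ + x₂x₃ + x₂x₃x₄ + x₁²x₂, r = 0, exc = {x₂})` with ONE recorded move — the point
`univ`, chart `x₂` (= `1`), translation `b = (0,0,0,1)`, child = row `0` (itself).  Only the point is
permissible there, so one move suffices. [folklore] -/
def trap1Cert : Cert (ZMod 2) :=
  [(⟨[(![0, 0, 1, 1], 1), (![0, 1, 1, 0], 1), (![0, 1, 1, 1], 1), (![2, 1, 0, 0], 1)], ![0, 0, 0, 0], {1}⟩,
    [⟨Finset.univ, 1, ![0, 0, 0, 1], 0⟩])]

/-- The checker accepts TRAP-1 (kernel evaluation). [folklore] -/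
theorem certB_trap1Cert : certB 2 trap1Cert = true := by decide

/-- … hence its state set is an `IsTrap 2` over `𝔽₂` — the soundness theorem at work (cf. the
hand-written `Trap1.isTrap_singleton`). [folklore] -/
theorem isTrap_trap1Cert : IsTrap 2 (states trap1Cert) := isTrap_of_certB certB_trap1Cert

end TrapCert

end Summit.ResolutionOfSingularities.ResolutionOfSingularities.Theorems.PIDim4
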